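import Literature.Geometry.Kaehler.ComplexTorusHodgeGroupPiNonCMEllipticCurvesProduct
import Literature.Geometry.Kaehler.ComplexTorusMumfordTateGroupHodgeCircleSigmaPiNonCMFactor
import Literature.Geometry.Kaehler.ComplexTorusHodgeGroupHodgeCircleComplexPointsInjective
import HarnessLib

/-!
# The Mumford–Tate group of `E₁ × ⋯ × E_m × ∏ₖ X_k` on complex AND real points, with unique parameters:
# `MT(ℂ) = {(diag_j C_j) ⊕ diag_k h_{ℂ,k}(z_{d(k)}, w_{d(k)}) : det C_j = z_i w_i = c}`,
# `MT(ℝ) = {(diag_j B_j) ⊕ diag_k h_k(z_{d(k)}) : det B_j = |z_i|² = c}`, and `Hg(ℂ) ≅ SL₂(ℂ)^m × (ℂ^×)^R` bijectively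
# (pairwise non-isogenous curves without complex multiplication, positive-dimensional locus tori; Imai 1976 §2–§3,
# Moonen–Zarhin 1999 §2 (2.2) and §3 Theorem (2), Lange Rem. 7.2.2 (2), Moonen 2004 (3.2))

Layer `Literature/Geometry/Kaehler`, namespace `Literature.Geometry.Kaehler.ComplexTorus`; lane `lit-hodgefound`
(Track 2 foundations library), Layer A3/A4 (Mumford–Tate groups of products; CM abelian varieties); prover seat
`lit-hodgefound-p17` (generation 36, self-proposed row g36-#3 = the seat sheet's pointer (θ) for `m` curves: the REAL
Mumford–Tate group and the uniqueness of the parameters, g35-#6/#8 generalised from `E × ∏ₖ X_k` to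
`E₁ × ⋯ × E_m × ∏ₖ X_k`). Consumed BY NAME, nothing restated: g36-#1 `ComplexTorusHodgeGroupPiNonCMEllipticCurvesProduct`
(`mem_mumfordTateGroupC_pi_prod_sigmaPiPeriod_iff_exists_of_homColouring`: `MT(ℂ) = ℂ^× · (SL₂(ℂ)^m × {diag ν_k(u_{d(k)})})`,
`mem_hodgeGroupC_pi_prod_sigmaPiPeriod_iff_exists_of_homColouring`), g35-#6 `ComplexTorusMumfordTateGroupHodgeCircleSigmaPiNonCMFactor`
(`smul_complexCircle_eq_hodgeSC`, `eq_conj_of_hodgeSC_eq_map_ofRealHom`, `hodgeSC_eq_hodgeSC_iff`; its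
`mem_mumfordTateGroup_prod_sigmaPiPeriod_iff_exists_of_homColouring` is the case `m = 1`), g35-#8
`ComplexTorusHodgeGroupHodgeCircleComplexPointsInjective` (`sigmaBlockDiagSL_complexCircleHom_comp_injective`), p40/p22
(`piBlockDiag`, `piDiagBlock`, `piBlockDiag_piDiagBlock_of_offDiag_eq_zero`, `det_piBlockDiag`, `piBlockDiagSLC_injective`,
`blockDiagC_injective`, `coe_scalar_mul_toGL`, `map_ofRealHom_mem_mumfordTateGroupC_iff`, `det_map_ofRealHom`, `det_hodgeS`,
`hodgeSC_conj`, `det_blockDiagonal'_eq_prod`). THEOREMS ONLY (no definition, no instance, no notation, no named fact;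
D-0026 net debt 0).

## Sources, verbatim

* H. Imai, Kōdai Math. Sem. Rep. **27** (1976) (held `paper:doi-10-2996-kmj-1138847263`), §2 p. 368 L5–L7: "`Hg(E)` is a
  1-dimensional torus if `E` is of CM-type […] `Hg(E) = SL₂` if `E` is not of CM-type"; §2 Proposition, third case
  (p. 370 L11–L15): "Therefore we have `H = H₁ × ⋯ × H_n`."; §3 Remarks (p. 370 L31–L40).
* B. Moonen, Yu. G. Zarhin, Math. Ann. **315** (1999) (held `paper:arxiv-math_9901113`), §2 (2.2) (p0005 L26–L49):
  "`U_F(R) = {x ∈ (F ⊗_ℚ R)^* | x x̄ = 1}` […] `MT(X) = T_F` […] `Hg(X) = U_F`"; §3 Theorem (2) (p0006 L70–L78).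
* H. Lange, *Abelian Varieties over the Complex Numbers* (2023), §7.2.1 Remark 7.2.2 (2): `MT(X) = 𝔾_m · Hg(X)`
  (almost direct product), the tree's `mem_mumfordTateGroupC_iff_exists_eq_scalar_mul` on complex points and
  `MT(ℝ) = MT(ℂ) ∩ GL(V_ℝ)` (`map_ofRealHom_mem_mumfordTateGroupC_iff`).
* B. Moonen, *An introduction to Mumford–Tate groups* (2004), (3.2): "`S(ℂ) = ℂ^* × ℂ^*` […] `h_ℂ`"; on real points
  the pairs `(z, z̄)`.
* J. Carlson, S. Müller-Stach, C. Peters (2017), §15.2 Problem 15.2.3 (a), (c) (`MT` of an elliptic curve: `GL₂` without,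
  a torus with complex multiplication).

## What is proved (`E_j = ℂ/Φ_j(ℤ²)` with `End_ℚ(E_j) = ℚ`, `Hom_ℚ(E_i, E_j) = 0` for `i ≠ j`; `X_k` positive-dimensional
tori on the Hodge-circle locus with a `Hom`-colouring `d : κ ↠ R`; carrier `prodPeriod (piPeriod Φ) (sigmaPiPeriod Ψ)`)

* §1 **COMPLEX POINTS, SPLIT FORM WITH THE MULTIPLIER**: `mem_mumfordTateGroupC_pi_prod_sigmaPiPeriod_iff_exists_hodgeSC_of_homColouring`
  — `g ∈ MT(ℂ) ⟺ g = (diag_j C_j) ⊕ diag_k h_{ℂ,k}(z_{d(k)}, w_{d(k)})` with `C_j ∈ M₂(ℂ)`, `z, w ∈ (ℂ^×)^R` and ONE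
  `c ∈ ℂ^×` with `det C_j = c = z_i w_i` for all `j, i` (the group `{(C, z, w) : det C_j = z_i w_i}` ≅ `𝔾_m ⋉`-free
  description of `ℂ^× · (SL₂^m × 𝔾_m^R)`; `⟸` takes a square root of `c`).
* §2 **REAL POINTS**: **`mem_mumfordTateGroup_pi_prod_sigmaPiPeriod_iff_exists_of_homColouring` — `g ∈ MT(E₁ × ⋯ × E_m × ∏ₖ X_k)(ℝ)
  ⟺ g = (diag_j B_j) ⊕ diag_k h_k(z_{d(k)})` with `B_j ∈ M₂(ℝ)`, `z ∈ ℂ^R` and one real `c` with `det B_j = c = |z_i|²`**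
  (no square root: reality of `h_{ℂ,k}(z, w)` forces `w = z̄`; for `m = 1` this is g35-#6, for `m = 0` g35-#1's
  `MT(∏ₖ X_k)(ℝ)`, for `κ = ∅` it reads `MT(∏_j E_j)(ℝ) = {diag B_j : det B_j = det B_{j'}}` — e.g. `MT(E)(ℝ) = GL₂(ℝ)`),
  `mem_mumfordTateGroup_pi_ellipticPeriod_prod_sigmaPiPeriod_iff` (`E_τ` wording).
* §3 **UNIQUE PARAMETERS**: `blockDiagC_piBlockDiagSLC_sigmaBlockDiagSL_injective` and
  `existsUnique_blockDiagC_eq_of_mem_hodgeGroupC_pi_prod_sigmaPiPeriod` (`Hg(ℂ) ≅ SL₂(ℂ)^m × (ℂ^×)^R` as a bijection);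
  `fromBlocks_piBlockDiag_hodgeSC_injective` (the data `(C, z, w)` of §1 are determined by `g`).

## References

* [Imai1976HodgeGroups] H. Imai, Kōdai Math. Sem. Rep. 27 (1976), §2 (p. 368), Proposition third case (p. 370), §3 Remarks.
* [MoonenZarhin1999LowDim] B. Moonen, Yu. G. Zarhin, Math. Ann. 315 (1999), §2 (2.2), §3 Theorem (2), §3 Corollary.
* [Lange2023AbelianVarietiesComplex] H. Lange (2023), §7.2.1 Remark 7.2.2 (2).
* [Moonen2004MT] B. Moonen (2004), (3.2), §4 (4.6) Lemma.
* [CarlsonMullerStachPeters2017] J. Carlson, S. Müller-Stach, C. Peters (2017), §15.2 Problem 15.2.3.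
-/

noncomputable section

open scoped Real MatrixGroups ComplexConjugate
open Complex Module Matrix Function

namespace Literature.Geometry.Kaehler

namespace ComplexTorus

section Mixed

variable {m : ℕ} (Φ : Fin m → ((Fin 2 → ℝ) ≃L[ℝ] ℂ))
  {κ : Type*} [Fintype κ] [DecidableEq κ] {σ : κ → Type*} [∀ k, Fintype (σ k)] [∀ k, DecidableEq (σ k)]
  {F : κ → Type*} [∀ k, NormedAddCommGroup (F k)] [∀ k, NormedSpace ℂ (F k)] [∀ k, FiniteDimensional ℂ (F k)]
  (Ψ : ∀ k, (σ k → ℝ) ≃L[ℝ] F k) {R : Type*} [Fintype R] [DecidableEq R] {d : κ → R}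
  (hE : ∀ j, endAlgRat (Φ j) = ⊥) (hhom : ∀ i j, i ≠ j → homRat (Φ i) (Φ j) = ⊥)

omit [Fintype κ] [DecidableEq κ] [∀ k, DecidableEq (σ k)] [Fintype R] [DecidableEq R] in
/-- Positive-dimensional factors have non-empty index types (`|σ k| = 2 dim X_k`). [folklore] -/
private theorem nonempty_index_of_finrank_pos_piMixed (Ψ : ∀ k, (σ k → ℝ) ≃L[ℝ] F k)
    (hg : ∀ k, 0 < finrank ℂ (F k)) (k : κ) : Nonempty (σ k) := by
  rw [← Fintype.card_pos_iff, card_eq_two_mul_finrank (Ψ k)]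
  exact Nat.mul_pos two_pos (hg k)

omit [∀ k, FiniteDimensional ℂ (F k)] [Fintype R] [DecidableEq R] in
/-- **The matrix of `α · ((diag_j A_j) ⊕ diag_k ν_k(u_{d(k)}))` is `(diag_j αA_j) ⊕ diag_k h_{ℂ,k}(αu_{d(k)}, αu_{d(k)}⁻¹)`**
(`α · ν(u) = h_ℂ(αu, αu⁻¹)`, g35-#6's `smul_complexCircle_eq_hodgeSC`, block by block). [cite: Moonen2004MT, (3.2)]
[cite: Lange2023AbelianVarietiesComplex, §7.2.1 Remark 7.2.2 (2)] -/
theorem coe_scalar_mul_toGL_blockDiagC_piBlockDiagSLC_sigmaBlockDiagSL (α : ℂˣ) (A : Fin m → SL(2, ℂ)) (u : R → ℂˣ) :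
    ((Matrix.GeneralLinearGroup.scalar ((Fin m × Fin 2) ⊕ Σ k, σ k) α * Matrix.SpecialLinearGroup.toGL
        (blockDiagC (Fin m × Fin 2) (Σ k, σ k)
          (piBlockDiagSLC A, sigmaBlockDiagSL σ ℂ fun k ↦ complexCircleHom (Ψ k) (u (d k)))) :
        GL ((Fin m × Fin 2) ⊕ Σ k, σ k) ℂ) : Matrix ((Fin m × Fin 2) ⊕ Σ k, σ k) ((Fin m × Fin 2) ⊕ Σ k, σ k) ℂ) =
      Matrix.fromBlocks (piBlockDiag fun j ↦ (α : ℂ) • (A j : Matrix (Fin 2) (Fin 2) ℂ)) 0 0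
        (Matrix.blockDiagonal' fun k ↦ hodgeSC (Ψ k) (α * u (d k)) (α * (u (d k) : ℂ)⁻¹)) := by
  have hf : ((α : ℂ) • fun k ↦ ((complexCircleHom (Ψ k) (u (d k)) : SpecialLinearGroup (σ k) ℂ) :
      Matrix (σ k) (σ k) ℂ)) = fun k ↦ hodgeSC (Ψ k) (α * u (d k)) (α * (u (d k) : ℂ)⁻¹) :=
    funext fun k ↦ by rw [Pi.smul_apply, coe_complexCircleHom, smul_complexCircle_eq_hodgeSC]
  have hA : ((α : ℂ) • fun j ↦ ((A j : SL(2, ℂ)) : Matrix (Fin 2) (Fin 2) ℂ)) =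
      fun j ↦ (α : ℂ) • (A j : Matrix (Fin 2) (Fin 2) ℂ) := rfl
  rw [coe_scalar_mul_toGL, coe_blockDiagC, coe_piBlockDiagSLC, coe_sigmaBlockDiagSL, Matrix.fromBlocks_smul, smul_zero,
    smul_zero, ← Matrix.blockDiagonal'_smul, hf, ← piBlockDiag_smul, hA]

/-! ## §1 Complex points, split form with the multiplier -/

include hE hhom in
/-- **`MT(E₁ × ⋯ × E_m × ∏ₖ X_k)(ℂ)` IN SPLIT FORM: `g ∈ MT(ℂ) ⟺ g = (diag_j C_j) ⊕ diag_k h_{ℂ,k}(z_{d(k)}, w_{d(k)})` with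
`C_j ∈ M₂(ℂ)`, `z, w ∈ (ℂ^×)^R` and a unit `c` with `det C_j = c` and `z_i w_i = c` for all `j`, `i`** (the multiplier;
`C_j = αA_j`, `(z_i, w_i) = (αu_i, αu_i⁻¹)`, `c = α²`; conversely `α = √c`). The groups `GL₂ ×_{det} ⋯ ×_{det} GL₂ ×_{det} T`
of Moonen–Zarhin's `MT = T_F` glued along the multiplier. [cite: MoonenZarhin1999LowDim, §2 (2.2) and §3 Theorem (2), §3 Corollary]
[cite: Lange2023AbelianVarietiesComplex, §7.2.1 Remark 7.2.2 (2)] [cite: Moonen2004MT, (3.2) and §4 (4.6) Lemma]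
[cite: Imai1976HodgeGroups, §2 Proposition, third case (p. 370 L11–L15) and §3 Remarks] -/
theorem mem_mumfordTateGroupC_pi_prod_sigmaPiPeriod_iff_exists_hodgeSC_of_homColouring (hg : ∀ k, 0 < finrank ℂ (F k))
    (h : ∀ k, (hodgeGroup (Ψ k) : Set (SpecialLinearGroup (σ k) ℝ)) = Set.range (hodgeCircleSL (Ψ k)))
    (hd : ∀ k l, d k = d l ↔ homRat (Ψ k) (Ψ l) ≠ ⊥) (hsurj : Surjective d)
    {g : GL ((Fin m × Fin 2) ⊕ Σ k, σ k) ℂ} :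
    g ∈ mumfordTateGroupC (prodPeriod (piPeriod Φ) (sigmaPiPeriod Ψ)) ↔
      ∃ (C : Fin m → Matrix (Fin 2) (Fin 2) ℂ) (z w : R → ℂˣ) (c : ℂˣ), (∀ j, (C j).det = c) ∧
        (∀ i, (z i : ℂ) * w i = c) ∧
          (g : Matrix ((Fin m × Fin 2) ⊕ Σ k, σ k) ((Fin m × Fin 2) ⊕ Σ k, σ k) ℂ) =
            Matrix.fromBlocks (piBlockDiag C) 0 0 (Matrix.blockDiagonal' fun k ↦ hodgeSC (Ψ k) (z (d k)) (w (d k))) := by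
  rw [mem_mumfordTateGroupC_pi_prod_sigmaPiPeriod_iff_exists_of_homColouring Φ Ψ hE hhom hg h hd hsurj]
  constructor
  · rintro ⟨α, A, u, rfl⟩
    refine ⟨fun j ↦ (α : ℂ) • (A j : Matrix (Fin 2) (Fin 2) ℂ), fun i ↦ α * u i, fun i ↦ α * (u i)⁻¹, α * α,
      fun j ↦ ?_, fun i ↦ ?_, ?_⟩
    · rw [Matrix.det_smul, (A j).2, mul_one, Fintype.card_fin, Units.val_mul, sq]
    · rw [Units.val_mul, Units.val_mul, Units.val_mul, mul_mul_mul_comm, Units.mul_inv, mul_one]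
    · rw [coe_scalar_mul_toGL_blockDiagC_piBlockDiagSLC_sigmaBlockDiagSL]
      simp only [Units.val_mul, Units.val_inv_eq_inv_val]
  · rintro ⟨C, z, w, c, hC, hzw, hgmat⟩
    -- `α² = c`, `A_j = α⁻¹ C_j`, `u_i = z_i / α`
    obtain ⟨α, hα⟩ := IsAlgClosed.exists_pow_nat_eq (c : ℂ) two_pos
    have hα0 : α ≠ 0 := fun h0 ↦ c.ne_zero (by rw [← hα, h0, zero_pow two_ne_zero])
    have hdetA : ∀ j, ((α⁻¹ : ℂ) • C j).det = 1 := fun j ↦ by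
      rw [Matrix.det_smul, Fintype.card_fin, hC j, ← hα, inv_pow, inv_mul_cancel₀ (pow_ne_zero 2 hα0)]
    set u : R → ℂˣ := fun i ↦ Units.mk0 (z i / α) (div_ne_zero (z i).ne_zero hα0) with hu
    have hu' : ∀ i, (u i : ℂ) = z i / α := fun i ↦ rfl
    have hw : ∀ i, α * (z i / α)⁻¹ = w i := fun i ↦ by
      rw [inv_div, mul_div_assoc', ← sq, hα, ← hzw i, mul_div_cancel_left₀ _ (z i).ne_zero]
    refine ⟨Units.mk0 α hα0, fun j ↦ ⟨_, hdetA j⟩, u, Units.ext ?_⟩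
    rw [hgmat, coe_scalar_mul_toGL_blockDiagC_piBlockDiagSLC_sigmaBlockDiagSL, Units.val_mk0]
    have hA : (fun j ↦ α • (((⟨(α⁻¹ : ℂ) • C j, hdetA j⟩ : SL(2, ℂ)) : Matrix (Fin 2) (Fin 2) ℂ))) = C :=
      funext fun j ↦ by
        show α • ((α⁻¹ : ℂ) • C j) = C j
        rw [smul_smul, mul_inv_cancel₀ hα0, one_smul]
    have hfun : (fun k ↦ hodgeSC (Ψ k) (α * u (d k)) (α * (u (d k) : ℂ)⁻¹)) =
        fun k ↦ hodgeSC (Ψ k) (z (d k)) (w (d k)) :=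
      funext fun k ↦ by rw [hu', mul_div_cancel₀ _ hα0, hw]
    rw [hA, hfun]

omit [Fintype κ] [Fintype R] [DecidableEq R] in
/-- **The data `(C, z, w)` of the split form are determined by `g`**: `(C, z, w) ↦ (diag_j C_j) ⊕ diag_k h_{ℂ,k}(z_{d(k)}, w_{d(k)})`
is injective (`d` onto, `dim X_k > 0`; `h_ℂ` injective in any dimension, g35-#6 `hodgeSC_eq_hodgeSC_iff`).
[cite: Moonen2004MT, (3.2) ("`S(ℂ) = ℂ^* × ℂ^*`")] [cite: MoonenZarhin1999LowDim, §2 (2.2) ("`T_F`")] -/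
theorem fromBlocks_piBlockDiag_hodgeSC_injective (hg : ∀ k, 0 < finrank ℂ (F k)) (hsurj : Surjective d) :
    Function.Injective fun Czw : (Fin m → Matrix (Fin 2) (Fin 2) ℂ) × (R → ℂ) × (R → ℂ) ↦
      Matrix.fromBlocks (piBlockDiag Czw.1) (0 : Matrix (Fin m × Fin 2) (Σ k, σ k) ℂ) 0
        (Matrix.blockDiagonal' fun k ↦ hodgeSC (Ψ k) (Czw.2.1 (d k)) (Czw.2.2 (d k))) := by
  haveI : ∀ k, Nonempty (σ k) := nonempty_index_of_finrank_pos_piMixed Ψ hg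
  rintro ⟨C, z, w⟩ ⟨C', z', w'⟩ hmat
  obtain ⟨h11, -, -, h22⟩ := Matrix.fromBlocks_inj.1 hmat
  have hi : ∀ i, z i = z' i ∧ w i = w' i := fun i ↦ by
    obtain ⟨k, rfl⟩ := hsurj i
    have hk := congrFun (Matrix.blockDiagonal'_injective h22) k
    exact (hodgeSC_eq_hodgeSC_iff (Ψ k)).1 hk
  exact Prod.ext (piBlockDiag_injective h11) (Prod.ext (funext fun i ↦ (hi i).1) (funext fun i ↦ (hi i).2))

/-! ## §2 Real points -/

include hE hhom in
/-- **THE REAL MUMFORD–TATE GROUP OF `E₁ × ⋯ × E_m × ∏ₖ X_k`.** For one-dimensional tori `E_j` with `End_ℚ(E_j) = ℚ`,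
`Hom_ℚ(E_i, E_j) = 0` (`i ≠ j`) and positive-dimensional tori `X_k` on the Hodge-circle locus with a `Hom`-colouring
`d : κ ↠ R`: **`g ∈ MT(ℝ) ⟺ g = (diag_j B_j) ⊕ diag_k h_k(z_{d(k)})` with `B_j ∈ M₂(ℝ)`, `z ∈ ℂ^R` and ONE real `c` with
`det B_j = c` for all `j` and `|z_i|² = c` for all `i`** (so `c > 0` and `det B_j > 0` as soon as `R ≠ ∅`; for `κ = ∅` the
common determinant may be negative: `MT(E)(ℝ) = GL₂(ℝ)`). The real form of §1: a REAL `h_{ℂ,k}(z, w)` has `w = z̄`, so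
`c = z z̄ = |z|²`, and a real `C_j` is `B_j ⊗ 1` with `det B_j = c` — no square root is taken. g35-#6's
`mem_mumfordTateGroup_prod_sigmaPiPeriod_iff_exists_of_homColouring` is `m = 1`. [cite: Imai1976HodgeGroups, §2 (p. 368 L5–L7), Proposition third case (p. 370 L11–L15), §3 Remarks (p. 370 L31–L40)]
[cite: MoonenZarhin1999LowDim, §2 (2.2) and §3 Theorem (2)] [cite: Lange2023AbelianVarietiesComplex, §7.2.1 Remark 7.2.2 (2)]
[cite: CarlsonMullerStachPeters2017, §15.2 Problem 15.2.3 (a), (c)] [cite: Moonen2004MT, (3.2)] -/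
theorem mem_mumfordTateGroup_pi_prod_sigmaPiPeriod_iff_exists_of_homColouring (hg : ∀ k, 0 < finrank ℂ (F k))
    (h : ∀ k, (hodgeGroup (Ψ k) : Set (SpecialLinearGroup (σ k) ℝ)) = Set.range (hodgeCircleSL (Ψ k)))
    (hd : ∀ k l, d k = d l ↔ homRat (Ψ k) (Ψ l) ≠ ⊥) (hsurj : Surjective d)
    {g : GL ((Fin m × Fin 2) ⊕ Σ k, σ k) ℝ} :
    g ∈ mumfordTateGroup (prodPeriod (piPeriod Φ) (sigmaPiPeriod Ψ)) ↔
      ∃ (B : Fin m → Matrix (Fin 2) (Fin 2) ℝ) (z : R → ℂ) (c : ℝ), (∀ j, (B j).det = c) ∧ (∀ i, ‖z i‖ ^ 2 = c) ∧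
        (g : Matrix ((Fin m × Fin 2) ⊕ Σ k, σ k) ((Fin m × Fin 2) ⊕ Σ k, σ k) ℝ) =
          Matrix.fromBlocks (piBlockDiag B) 0 0 (Matrix.blockDiagonal' fun k ↦ hodgeS (Ψ k) (z (d k))) := by
  haveI : ∀ k, Nonempty (σ k) := nonempty_index_of_finrank_pos_piMixed Ψ hg
  rw [← map_ofRealHom_mem_mumfordTateGroupC_iff,
    mem_mumfordTateGroupC_pi_prod_sigmaPiPeriod_iff_exists_hodgeSC_of_homColouring Φ Ψ hE hhom hg h hd hsurj,
    coe_generalLinearGroup_map_ofRealHom]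
  constructor
  · rintro ⟨C, z, w, c, hC, hzw, hmat⟩
    rw [← Matrix.fromBlocks_toBlocks (g : Matrix ((Fin m × Fin 2) ⊕ Σ k, σ k) ((Fin m × Fin 2) ⊕ Σ k, σ k) ℝ),
      Matrix.fromBlocks_map, Matrix.fromBlocks_inj] at hmat
    obtain ⟨h11, h12, h21, h22⟩ := hmat
    set g₁₁ := (g : Matrix ((Fin m × Fin 2) ⊕ Σ k, σ k) ((Fin m × Fin 2) ⊕ Σ k, σ k) ℝ).toBlocks₁₁ with hg₁₁
    -- the curve blocks: `g₁₁` is block diagonal with REAL blocks `B_j`, `B_j ⊗ 1 = C_j`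
    have hoff : ∀ p q : Fin m × Fin 2, p.1 ≠ q.1 → g₁₁ p q = 0 := fun p q hpq ↦ by
      have e := congrFun (congrFun h11 p) q
      rw [Matrix.map_apply, piBlockDiag_apply, if_neg hpq] at e
      exact Complex.ofReal_eq_zero.1 e
    have hB : ∀ j, (piDiagBlock g₁₁ j).map Complex.ofRealHom = C j := fun j ↦ by
      have e := congrArg (fun M ↦ piDiagBlock M j) h11
      simp only [piDiagBlock_piBlockDiag] at e
      rw [← e]
      rfl
    have hdetB : ∀ j, (((piDiagBlock g₁₁ j).det : ℝ) : ℂ) = c := fun j ↦ by rw [← det_map_ofRealHom, hB j, hC j]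
    -- the locus blocks are real: `w_i = conj z_i`, so `c = |z_i|²`
    have hw : ∀ i, (w i : ℂ) = conj (z i : ℂ) := fun i ↦ by
      obtain ⟨k, hk⟩ := hsurj i
      have hk22 := congrArg (fun M ↦ Matrix.blockDiag' M k) h22
      simp only [Matrix.blockDiag'_map, Matrix.blockDiag'_blockDiagonal', hk] at hk22
      exact eq_conj_of_hodgeSC_eq_map_ofRealHom (Ψ k) hk22.symm
    have hzc : ∀ i, ((‖(z i : ℂ)‖ ^ 2 : ℝ) : ℂ) = c := fun i ↦ by
      rw [← Complex.normSq_eq_norm_sq, ← Complex.mul_conj, ← hw i, hzw i]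
    refine ⟨fun j ↦ piDiagBlock g₁₁ j, fun i ↦ z i, (c : ℂ).re, fun j ↦ ?_, fun i ↦ ?_, ?_⟩
    · rw [← hdetB j, Complex.ofReal_re]
    · rw [← hzc i, Complex.ofReal_re]
    · have h12' : (g : Matrix ((Fin m × Fin 2) ⊕ Σ k, σ k) ((Fin m × Fin 2) ⊕ Σ k, σ k) ℝ).toBlocks₁₂ = 0 :=
        Matrix.map_injective Complex.ofReal_injective (h12.trans (Matrix.map_zero _ (map_zero Complex.ofRealHom)).symm)
      have h21' : (g : Matrix ((Fin m × Fin 2) ⊕ Σ k, σ k) ((Fin m × Fin 2) ⊕ Σ k, σ k) ℝ).toBlocks₂₁ = 0 :=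
        Matrix.map_injective Complex.ofReal_injective (h21.trans (Matrix.map_zero _ (map_zero Complex.ofRealHom)).symm)
      have hfun : (fun k ↦ hodgeSC (Ψ k) (z (d k)) (w (d k))) =
          fun k ↦ (hodgeS (Ψ k) (z (d k))).map Complex.ofRealHom :=
        funext fun k ↦ by rw [hw (d k), hodgeSC_conj]
      have h22' : (g : Matrix ((Fin m × Fin 2) ⊕ Σ k, σ k) ((Fin m × Fin 2) ⊕ Σ k, σ k) ℝ).toBlocks₂₂ =
          Matrix.blockDiagonal' fun k ↦ hodgeS (Ψ k) (z (d k)) :=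
        Matrix.map_injective Complex.ofReal_injective
          (h22.trans (by rw [hfun, ← Matrix.blockDiagonal'_map _ _ (map_zero Complex.ofRealHom)]; rfl))
      have h11' : g₁₁ = piBlockDiag fun j ↦ piDiagBlock g₁₁ j := (piBlockDiag_piDiagBlock_of_offDiag_eq_zero hoff).symm
      conv_lhs => rw [← Matrix.fromBlocks_toBlocks
        (g : Matrix ((Fin m × Fin 2) ⊕ Σ k, σ k) ((Fin m × Fin 2) ⊕ Σ k, σ k) ℝ)]
      rw [← hg₁₁, h12', h21', h22', Matrix.fromBlocks_inj]
      exact ⟨h11', rfl, rfl, rfl⟩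
  · rintro ⟨B, z, c, hdetB, hz, hgmat⟩
    by_cases hc : c = 0
    · -- degenerate data: every block is singular, so the index type is empty and `g = 1`
      have hdet : (g : Matrix ((Fin m × Fin 2) ⊕ Σ k, σ k) ((Fin m × Fin 2) ⊕ Σ k, σ k) ℝ).det ≠ 0 :=
        ((Matrix.isUnit_iff_isUnit_det _).1 (Units.isUnit g)).ne_zero
      rw [hgmat, Matrix.det_fromBlocks_zero₂₁, det_piBlockDiag, det_blockDiagonal'_eq_prod] at hdet
      haveI hm : IsEmpty (Fin m) := ⟨fun j ↦ hdet (mul_eq_zero_of_left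
        (Finset.prod_eq_zero (Finset.mem_univ j) (by rw [hdetB j, hc])) _)⟩
      haveI hκ : IsEmpty κ := ⟨fun k ↦ hdet (mul_eq_zero_of_right _
        (Finset.prod_eq_zero (Finset.mem_univ k) (by
          have hz0 : z (d k) = 0 := by
            have := hz (d k); rw [hc, sq_eq_zero_iff, norm_eq_zero] at this; exact this
          rw [hz0, hodgeS_zero, Matrix.det_zero])))⟩
      haveI hR : IsEmpty R := ⟨fun i ↦ by obtain ⟨k, -⟩ := hsurj i; exact IsEmpty.false k⟩
      haveI : IsEmpty (Fin m × Fin 2) := ⟨fun p ↦ IsEmpty.false p.1⟩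
      haveI : IsEmpty (Σ k, σ k) := ⟨fun x ↦ IsEmpty.false x.1⟩
      exact ⟨fun j ↦ isEmptyElim j, fun i ↦ isEmptyElim i, fun i ↦ isEmptyElim i, 1, fun j ↦ isEmptyElim j,
        fun i ↦ isEmptyElim i, Subsingleton.elim _ _⟩
    · -- `C_j = B_j ⊗ 1`, `(z_i, w_i) = (z_i, z̄_i)`, `c = c`
      have hz0 : ∀ i, z i ≠ 0 := fun i h0 ↦ hc (by rw [← hz i, h0, norm_zero, zero_pow two_ne_zero])
      have hc0 : (c : ℂ) ≠ 0 := Complex.ofReal_ne_zero.2 hc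
      refine ⟨fun j ↦ (B j).map Complex.ofRealHom, fun i ↦ Units.mk0 (z i) (hz0 i),
        fun i ↦ Units.mk0 (conj (z i)) ((map_ne_zero_iff _ (RingHom.injective _)).2 (hz0 i)), Units.mk0 (c : ℂ) hc0,
        fun j ↦ by rw [det_map_ofRealHom, hdetB j, Units.val_mk0], fun i ↦ ?_, ?_⟩
      · rw [Units.val_mk0, Units.val_mk0, Units.val_mk0, Complex.mul_conj, Complex.normSq_eq_norm_sq, hz i]
      · rw [hgmat, Matrix.fromBlocks_map, Matrix.map_zero _ (map_zero _), Matrix.map_zero _ (map_zero _),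
          Matrix.blockDiagonal'_map _ _ (map_zero Complex.ofRealHom), piBlockDiag_map _ (map_zero Complex.ofRealHom)]
        have hfun : (fun k ↦ (hodgeS (Ψ k) (z (d k))).map Complex.ofRealHom) =
            fun k ↦ hodgeSC (Ψ k) (Units.mk0 (z (d k)) (hz0 (d k)))
              (Units.mk0 (conj (z (d k))) ((map_ne_zero_iff _ (RingHom.injective _)).2 (hz0 (d k)))) :=
          funext fun k ↦ by rw [Units.val_mk0, Units.val_mk0, hodgeSC_conj]
        rw [hfun]

include hE hhom in
/-- **Positivity**: with at least one locus factor, the common value is `c = |z_i|² > 0`, so every curve block of an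
element of `MT(E₁ × ⋯ × E_m × ∏ₖ X_k)(ℝ)` has POSITIVE determinant (the multiplier is a norm).
[cite: MoonenZarhin1999LowDim, §2 (2.2) ("`x x̄`")] [cite: Lange2023AbelianVarietiesComplex, §7.2.1 Remark 7.2.2 (2)] -/
theorem exists_pos_of_mem_mumfordTateGroup_pi_prod_sigmaPiPeriod [Nonempty R] (hg : ∀ k, 0 < finrank ℂ (F k))
    (h : ∀ k, (hodgeGroup (Ψ k) : Set (SpecialLinearGroup (σ k) ℝ)) = Set.range (hodgeCircleSL (Ψ k)))
    (hd : ∀ k l, d k = d l ↔ homRat (Ψ k) (Ψ l) ≠ ⊥) (hsurj : Surjective d)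
    {g : GL ((Fin m × Fin 2) ⊕ Σ k, σ k) ℝ} (hgm : g ∈ mumfordTateGroup (prodPeriod (piPeriod Φ) (sigmaPiPeriod Ψ))) :
    ∃ (B : Fin m → Matrix (Fin 2) (Fin 2) ℝ) (z : R → ℂ) (c : ℝ), 0 < c ∧ (∀ j, (B j).det = c) ∧ (∀ i, ‖z i‖ ^ 2 = c) ∧
      (g : Matrix ((Fin m × Fin 2) ⊕ Σ k, σ k) ((Fin m × Fin 2) ⊕ Σ k, σ k) ℝ) =
        Matrix.fromBlocks (piBlockDiag B) 0 0 (Matrix.blockDiagonal' fun k ↦ hodgeS (Ψ k) (z (d k))) := by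
  haveI : ∀ k, Nonempty (σ k) := nonempty_index_of_finrank_pos_piMixed Ψ hg
  obtain ⟨B, z, c, hdetB, hz, hgmat⟩ :=
    (mem_mumfordTateGroup_pi_prod_sigmaPiPeriod_iff_exists_of_homColouring Φ Ψ hE hhom hg h hd hsurj).1 hgm
  refine ⟨B, z, c, ?_, hdetB, hz, hgmat⟩
  obtain ⟨i₀⟩ := ‹Nonempty R›
  obtain ⟨k₀, hk₀⟩ := hsurj i₀
  rcases (hz i₀ ▸ sq_nonneg ‖z i₀‖ : (0 : ℝ) ≤ c).eq_or_lt with h0 | hpos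
  · -- `c = 0` would make the `k₀`-block singular
    exfalso
    have hdet : (g : Matrix ((Fin m × Fin 2) ⊕ Σ k, σ k) ((Fin m × Fin 2) ⊕ Σ k, σ k) ℝ).det ≠ 0 :=
      ((Matrix.isUnit_iff_isUnit_det _).1 (Units.isUnit g)).ne_zero
    rw [hgmat, Matrix.det_fromBlocks_zero₂₁, det_piBlockDiag, det_blockDiagonal'_eq_prod] at hdet
    refine hdet (mul_eq_zero_of_right _ (Finset.prod_eq_zero (Finset.mem_univ k₀) ?_))
    have hz0 : z (d k₀) = 0 := by
      have := hz (d k₀); rw [← h0, sq_eq_zero_iff, norm_eq_zero] at this; exact this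
    rw [hz0, hodgeS_zero, Matrix.det_zero]
  · exact hpos

/-- `E_τ` wording: **`g ∈ MT(E_{τ₁} × ⋯ × E_{τ_m} × ∏ₖ X_k)(ℝ) ⟺ g = (diag_j B_j) ⊕ diag_k h_k(z_{d(k)})`, `det B_j = c = |z_i|²`**,
for pairwise non-isogenous curves with `End(E_{τ_j}) = ℤ`. [cite: Imai1976HodgeGroups, §2 Proposition (p. 368 L11–L13) and §3 Remarks (p. 370 L31–L40)]
[cite: MoonenZarhin1999LowDim, §3 Theorem (2) and §2 (2.2)] -/
theorem mem_mumfordTateGroup_pi_ellipticPeriod_prod_sigmaPiPeriod_iff {τ : Fin m → ℂ} (hτ : ∀ j, (τ j).im ≠ 0)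
    (hEnd : ∀ j, ellipticEnd (hτ j) = ⊥)
    (hiso : ∀ i j, i ≠ j → ¬ IsIsogenous (ellipticPeriod (hτ i)) (ellipticPeriod (hτ j)))
    (hg : ∀ k, 0 < finrank ℂ (F k))
    (h : ∀ k, (hodgeGroup (Ψ k) : Set (SpecialLinearGroup (σ k) ℝ)) = Set.range (hodgeCircleSL (Ψ k)))
    (hd : ∀ k l, d k = d l ↔ homRat (Ψ k) (Ψ l) ≠ ⊥) (hsurj : Surjective d)
    {g : GL ((Fin m × Fin 2) ⊕ Σ k, σ k) ℝ} :
    g ∈ mumfordTateGroup (prodPeriod (piPeriod fun j ↦ ellipticPeriod (hτ j)) (sigmaPiPeriod Ψ)) ↔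
      ∃ (B : Fin m → Matrix (Fin 2) (Fin 2) ℝ) (z : R → ℂ) (c : ℝ), (∀ j, (B j).det = c) ∧ (∀ i, ‖z i‖ ^ 2 = c) ∧
        (g : Matrix ((Fin m × Fin 2) ⊕ Σ k, σ k) ((Fin m × Fin 2) ⊕ Σ k, σ k) ℝ) =
          Matrix.fromBlocks (piBlockDiag B) 0 0 (Matrix.blockDiagonal' fun k ↦ hodgeS (Ψ k) (z (d k))) :=
  mem_mumfordTateGroup_pi_prod_sigmaPiPeriod_iff_exists_of_homColouring (fun j ↦ ellipticPeriod (hτ j)) Ψ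
    (fun j ↦ (endAlgRat_ellipticPeriod_eq_bot_iff (hτ j)).2 (hEnd j))
    (fun i j hij ↦ homRat_ellipticPeriod_eq_bot_of_not_isIsogenous (hτ i) (hτ j) (hiso i j hij)) hg h hd hsurj

/-! ## §3 `Hg(E₁ × ⋯ × E_m × ∏ₖ X_k)(ℂ) ≅ SL₂(ℂ)^m × (ℂ^×)^R` as a bijection -/

omit [Fintype R] [DecidableEq R] in
/-- **`(B, u) ↦ (diag_j B_j) ⊕ diag_k ν_k(u_{d(k)})` is injective on `SL₂(ℂ)^m × (ℂ^×)^R`** (`d` onto, `dim X_k > 0`; g35-#8's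
`sigmaBlockDiagSL_complexCircleHom_comp_injective` for the locus block). [cite: MoonenZarhin1999LowDim, §2 (2.2) ("`U_F`") and §3 Corollary]
[cite: Imai1976HodgeGroups, §3 Remarks (p. 370 L31–L40)] -/
theorem blockDiagC_piBlockDiagSLC_sigmaBlockDiagSL_injective (hg : ∀ k, 0 < finrank ℂ (F k)) (hsurj : Surjective d) :
    Function.Injective fun Bu : (Fin m → SL(2, ℂ)) × (R → ℂˣ) ↦ blockDiagC (Fin m × Fin 2) (Σ k, σ k)
      (piBlockDiagSLC Bu.1, sigmaBlockDiagSL σ ℂ fun k ↦ complexCircleHom (Ψ k) (Bu.2 (d k))) := by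
  rintro ⟨B, u⟩ ⟨B', u'⟩ hBu
  have h := Prod.mk.inj (blockDiagC_injective (Fin m × Fin 2) (Σ k, σ k) hBu)
  exact Prod.ext (piBlockDiagSLC_injective h.1) (sigmaBlockDiagSL_complexCircleHom_comp_injective Ψ hg hsurj h.2)

include hE hhom in
/-- **`Hg(E₁ × ⋯ × E_m × ∏ₖ X_k)(ℂ) ≅ SL₂(ℂ)^m × (ℂ^×)^R` BIJECTIVELY**: every `M ∈ Hg(ℂ)` is `(diag_j B_j) ⊕ diag_k ν_k(u_{d(k)})` for a
UNIQUE pair `(B, u)`. [cite: MoonenZarhin1999LowDim, §2 (2.2), §3 Theorem (2) and §3 Corollary]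
[cite: Imai1976HodgeGroups, §2 Proposition third case (p. 370 L11–L15) and §3 Remarks] -/
theorem existsUnique_blockDiagC_eq_of_mem_hodgeGroupC_pi_prod_sigmaPiPeriod (hg : ∀ k, 0 < finrank ℂ (F k))
    (h : ∀ k, (hodgeGroup (Ψ k) : Set (SpecialLinearGroup (σ k) ℝ)) = Set.range (hodgeCircleSL (Ψ k)))
    (hd : ∀ k l, d k = d l ↔ homRat (Ψ k) (Ψ l) ≠ ⊥) (hsurj : Surjective d)
    {M : SpecialLinearGroup ((Fin m × Fin 2) ⊕ Σ k, σ k) ℂ}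
    (hM : M ∈ hodgeGroupC (prodPeriod (piPeriod Φ) (sigmaPiPeriod Ψ))) :
    ∃! Bu : (Fin m → SL(2, ℂ)) × (R → ℂˣ), blockDiagC (Fin m × Fin 2) (Σ k, σ k)
      (piBlockDiagSLC Bu.1, sigmaBlockDiagSL σ ℂ fun k ↦ complexCircleHom (Ψ k) (Bu.2 (d k))) = M := by
  obtain ⟨B, u, rfl⟩ := (mem_hodgeGroupC_pi_prod_sigmaPiPeriod_iff_exists_of_homColouring Φ Ψ hE hhom hg h hd hsurj).1 hM
  exact ⟨(B, u), rfl, fun Bu hBu ↦ blockDiagC_piBlockDiagSLC_sigmaBlockDiagSL_injective Ψ hg hsurj hBu⟩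

end Mixed

end ComplexTorus

end Literature.Geometry.Kaehler

end
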